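import Summits.QuantumFields.YangMills.Theorems.BalabanUVNodesN27AtRecord13CoPHHomeOn
import Summits.QuantumFields.YangMills.Theorems.BalabanUVNodesN15AtRRec13CoPHOn

/-!
# BalabanUVNodes ∕ N27 = binder B5 AT THE RECORD — XXXIXᶜᵒᵖᴴ's REGIME-HOME KNIT WITH THE N15 SLOT IN dag-n15's CURRENCIES AT THE HOME (trigger (t2) of this seat: a producer face in a NEW
# currency at the v1.7 `CoPH` homes; companion of `…N27AtRecord13CoPHHomeOnN14` p547998): `S_N15 (RRec₁₃CoPHOn 𝔯 Rg)` — the one rate slot XXXIXᶜᵒᵖᴴ ∕ leaf B still displayed in stub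
# form at the home (dag-n15-a part 74b's header: «N15 being the one rate slot without a producer face there (dag-n27-c FIELD-TABLE-R13CoPH.md). This file gives the N15 side at that
# home») — is REPLACED by (a) NE2's guarded θ-level form «`N15At (ne2OfRecord₁₁ ((𝔯.lit F θ hP g₀ os).ne2 k))` at every admissible Stage-13H tuple with provisos in the regime», (b) the
# three NE2⁺ layers spelled out there, (c) the LG-vector KNIT READING equation (MODEL level: the reading's NE2 objects are dag-n15-a's `U ≡ 1` knit carriers — then NO estimate is asked
# in the N15 slot) — ONE application each of dag-n15-a's `s_N15_rRec₁₃CoPHOn_of_forall_regime` ∕ `…_of_layers_forall_regime` ∕ `…_of_knitReading` (`…N15AtRRec13CoPHOn`, part 74b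
# p549175 ✓) composed with XXXIXᶜᵒᵖᴴ `spine_rec13CCoPHOn_of_homes₁₃CoPHOn` (p544545 ✓); §2 the three at the guard of record (RR-2's CN class)
# (cell `pub-ymgap`, HUMAN RULING D-0062 Track A, R134 seat `pub-ymgap-dag-n27-c` (s2) gen 9; K3⁷ `SpineGivenEndpointR13SepCoPH` = stmt-QuantumFields-20544, `--kind proof --supports 20544 --as helper`;
# COUNT-NEUTRAL; `N`-generic, NO Theses import — the item-facing face is ONE application of leaf B `spineGivenEndpointR13SepCoPH_of_homes₁₃CoPHCN` at `N = 2` at the call site)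

WHAT IS KERNEL-CHECKED ([bookkeeping]; 0 `def`, 0 `sorry`):
* `spine_rec13CCoPHOn_of_homes₁₃CoPHOn_n15At` ∕ `…_n15Layers` ∕ `…_n15KnitReading` — B5 `Spine` at RR-2's regime record class `Node00.IsRecordOfRecord₁₃CCoPHOn F N Rg` from: NE2 in its
  guarded θ-level form ∕ as the three NE2⁺ layers ∕ nothing (at the knit reading) in the N15 slot, the other five K4 stubs at `RRec₁₃CoPHOn 𝔯 Rg`, N20 ∕ N21 at `SRec₁₃CoPHOn cr Rg`, the
  guarded keyed extraction clause and the same-tuple N19′ edge;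
* `spine_rec13CCoPHN_of_homes₁₃CoPHOn_n15At` ∕ `…_n15Layers` ∕ `…_n15KnitReading` — the three at the guard of record `Rg := Node00.unityNondeg₁₃H N`, landing in RR-2's CN class
  `Node00.IsRecordOfRecord₁₃CCoPHN F N` — at `N = 2` one application of leaf B short of K3⁷.

HONEST FRAMING.  COMPOSITE-node bookkeeping: every K4∕K5 stub, the extraction clause, the edge AND the N15 antecedent (NE2 at the reading's NE2 objects — Node 00's pin of `𝔯.lit · ne2` to
Bałaban's run-indexed paired instances with LIVE backgrounds is residual and NOT the knit model; no producer of NE2⁺ beyond King's scalar template) are HYPOTHESES (0∕1); the readings `cr`,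
`𝔯` are PARAMETERS; the knit-reading faces are MODEL level in the N15 slot and their distance to the statement of record is exactly the reading equation; nothing of Bałaban's asserted;
NE7 ∕ NE7b ∕ NE7c NOT PRINTED for d = 4 and NOT PROVED; N15 and N27 NOT discharged; K3⁷ NOT claimed; no `Provisos₁₃CoPH` inhabitant claimed (K0⁷ open — where no guarded admissible tuple
exists every guarded stub is vacuous, dag-n15-a `s_N15_rRec₁₃CoPHOn_of_guard_empty`); counts UNMOVED (typed 28∕28 · discharged 5∕27, A 5∕28); one finite four-torus programme at fixed
`ε` — NOT ℝ⁴, NOT infinite volume, NOT OS, NOT a mass gap, NOT Clay.  No decl below carries a cite tag.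
-/

noncomputable section

namespace Summit.QuantumFields.YangMills.Theorems.BalabanUVNodesN27SpineRecord

open Literature.MathematicalPhysics.QuantumFieldTheory.Balaban1983to89
open Literature.MathematicalPhysics.QuantumFieldTheory.Balaban1983to89.T4Continuum
open Literature.MathematicalPhysics.QuantumFieldTheory.Balaban1983to89.T4EtaRate (NE2PlusOperator NE2PlusSite NE2PlusUnit)
open Literature.MathematicalPhysics.QuantumFieldTheory.Balaban1983to89.NE2NodeTorus (KnitIndex knitInstance knitOp166 knitSite163 covOpKernels inAll rhoDist)
open T4ContinuumYM4Torus (ForSmallCouplings)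
open Summit.QuantumFields.BalabanUV.T4Continuum.Spine
open YMDAG.UVSplit
open Summit.QuantumFields.YangMills.BalabanUVNodes.N15.AtRRec13CoPH (s_N15_rRec₁₃CoPHOn_of_forall_regime s_N15_rRec₁₃CoPHOn_of_layers_forall_regime s_N15_rRec₁₃CoPHOn_of_knitReading)
open Node00 (Stage13HParams datumOfRecord₁₃CoPH)

variable {N : ℕ} [NeZero N] (cr : SpineReading₁₃CoPH N) (𝔯 : RateReading₁₃CoPH N) (Rg : (F : T4Family) → Stage13HParams F N → Prop)

/-! ## §1 The regime-home knit with N15 in dag-n15-a's guarded θ-level currencies -/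

/-- **N27 = B5 AT THE REGIME RECORD CLASS, N15 READ AS NE2 AT THE READING's NE2 OBJECTS** (the guarded θ-form `h15` of dag-n15-a part 74b): XXXIXᶜᵒᵖᴴ
`spine_rec13CCoPHOn_of_homes₁₃CoPHOn` with its hypothesis `S_N15 (RRec₁₃CoPHOn 𝔯 Rg)` supplied by `s_N15_rRec₁₃CoPHOn_of_forall_regime` from «`N15At (ne2OfRecord₁₁ ((𝔯.lit F θ hP g₀ os).ne2 k))`
at every admissible Stage-13 tuple with provisos in the regime, every `(g₀, os, k)`».  Every hypothesis 0∕1 today. [bookkeeping] -/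
theorem spine_rec13CCoPHOn_of_homes₁₃CoPHOn_n15At
    (h14 : S_N14 (RRec₁₃CoPHOn 𝔯 Rg))
    (h15 : ∀ (F : T4Family) (θ : Stage13HParams F N) (hP : θ.Provisos₁₃CoPH F N), Rg F θ → θ.Admissible F N → ∀ (g₀ : ℕ → ℝ) (os : List (ULoop F)) (k : ℕ),
      N15At (ne2OfRecord₁₁ ((𝔯.lit F θ hP g₀ os).ne2 k)))
    (h16 : S_N16 (RRec₁₃CoPHOn 𝔯 Rg)) (h17 : S_N17 (RRec₁₃CoPHOn 𝔯 Rg))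
    (h18 : S_N18 (RRec₁₃CoPHOn 𝔯 Rg)) (h22 : S_N22 (RRec₁₃CoPHOn 𝔯 Rg)) (h20 : S_N20 (SRec₁₃CoPHOn cr Rg)) (h21 : S_N21 (SRec₁₃CoPHOn cr Rg))
    (hx : ∀ (F : T4Family) (θ : Stage13HParams F N) (hP : θ.Provisos₁₃CoPH F N), Rg F θ → θ.Admissible F N →
      B16.EndStatementBPrinted (datumOfRecord₁₃CoPH F N θ hP).C → DagBinding.EndpointExistence (datumOfRecord₁₃CoPH F N θ hP).C.toB12 →
        ForSmallCouplings (datumOfRecord₁₃CoPH F N θ hP) fun g₀ => ∀ os : List (ULoop F),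
          0 < (cr F θ hP g₀ os).l₀ ∧ 0 < (cr F θ hP g₀ os).vol ∧
          (∀ (K : ℕ) (t : ℝ), |t| ≤ (cr F θ hP g₀ os).l₀ →
            T4GenFunBounds.schemeZ ((datumOfRecord₁₃CoPH F N θ hP).scheme g₀) os ((cr F θ hP g₀ os).K₀ + K) t =
              ∑ τ ∈ (cr F θ hP g₀ os).T K, (cr F θ hP g₀ os).A K t τ) ∧
          (∀ (K : ℕ) (t : ℝ), |t| ≤ (cr F θ hP g₀ os).l₀ →
            T4GenFunBounds.schemeZ ((datumOfRecord₁₃CoPH F N θ hP).scheme g₀) os ((cr F θ hP g₀ os).K₀ + K + 1) t =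
              ∑ τ ∈ (cr F θ hP g₀ os).T K, (cr F θ hP g₀ os).B K t τ))
    (h19 : ∀ (F : T4Family) (θ : Stage13HParams F N) (hP : θ.Provisos₁₃CoPH F N), Rg F θ → θ.Admissible F N → ∀ (g₀ : ℕ → ℝ) (os : List (ULoop F)),
      (∀ k : ℕ, RatesAt (datumOfRecord₁₃CoPH F N θ hP) (rateCarriersOfRecord₁₃CoPH 𝔯 F θ hP g₀ os k)) → letI := (cr F θ hP g₀ os).dec
        ∃ δ : ℕ → ℝ, NE7.Core (cr F θ hP g₀ os).l₀ (cr F θ hP g₀ os).vol (cr F θ hP g₀ os).T (cr F θ hP g₀ os).Bad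
          (fun K t τ => (cr F θ hP g₀ os).A K t τ - (cr F θ hP g₀ os).shA K t τ) (fun K t τ => (cr F θ hP g₀ os).B K t τ - (cr F θ hP g₀ os).shB K t τ) δ ∧
          Summable δ) :
    Spine (N := N) fun F D w => Node00.IsRecordOfRecord₁₃CCoPHOn F N Rg D w :=
  spine_rec13CCoPHOn_of_homes₁₃CoPHOn cr 𝔯 Rg h14 (s_N15_rRec₁₃CoPHOn_of_forall_regime 𝔯 Rg h15) h16 h17 h18 h22 h20 h21 hx h19

/-- **N27 = B5 AT THE REGIME RECORD CLASS, N15 AS THE THREE NE2⁺ LAYERS SPELLED OUT** (dag-n15-a part 74b `s_N15_rRec₁₃CoPHOn_of_layers_forall_regime`): the operator ∕ site ∕ unit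
layers `NE2PlusOperator` ∕ `NE2PlusSite 4` ∕ `NE2PlusUnit` of the reading's NE2 objects at every admissible tuple with provisos in the regime replace `h15`.  Every hypothesis 0∕1
today. [bookkeeping] -/
theorem spine_rec13CCoPHOn_of_homes₁₃CoPHOn_n15Layers
    (h14 : S_N14 (RRec₁₃CoPHOn 𝔯 Rg))
    (h15 : ∀ (F : T4Family) (θ : Stage13HParams F N) (hP : θ.Provisos₁₃CoPH F N), Rg F θ → θ.Admissible F N → ∀ (g₀ : ℕ → ℝ) (os : List (ULoop F)) (k : ℕ),
      NE2PlusOperator ((𝔯.lit F θ hP g₀ os).ne2 k).c35 ((𝔯.lit F θ hP g₀ os).ne2 k).pi ((𝔯.lit F θ hP g₀ os).ne2 k).Kop ∧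
      NE2PlusSite 4 ((𝔯.lit F θ hP g₀ os).ne2 k).p ((𝔯.lit F θ hP g₀ os).ne2 k).c35 ((𝔯.lit F θ hP g₀ os).ne2 k).pi ((𝔯.lit F θ hP g₀ os).ne2 k).Ksite ∧
      NE2PlusUnit ((𝔯.lit F θ hP g₀ os).ne2 k).c35 ((𝔯.lit F θ hP g₀ os).ne2 k).pi ((𝔯.lit F θ hP g₀ os).ne2 k).Kunit ((𝔯.lit F θ hP g₀ os).ne2 k).inΛ
        ((𝔯.lit F θ hP g₀ os).ne2 k).unitDist)
    (h16 : S_N16 (RRec₁₃CoPHOn 𝔯 Rg)) (h17 : S_N17 (RRec₁₃CoPHOn 𝔯 Rg))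
    (h18 : S_N18 (RRec₁₃CoPHOn 𝔯 Rg)) (h22 : S_N22 (RRec₁₃CoPHOn 𝔯 Rg)) (h20 : S_N20 (SRec₁₃CoPHOn cr Rg)) (h21 : S_N21 (SRec₁₃CoPHOn cr Rg))
    (hx : ∀ (F : T4Family) (θ : Stage13HParams F N) (hP : θ.Provisos₁₃CoPH F N), Rg F θ → θ.Admissible F N →
      B16.EndStatementBPrinted (datumOfRecord₁₃CoPH F N θ hP).C → DagBinding.EndpointExistence (datumOfRecord₁₃CoPH F N θ hP).C.toB12 →
        ForSmallCouplings (datumOfRecord₁₃CoPH F N θ hP) fun g₀ => ∀ os : List (ULoop F),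
          0 < (cr F θ hP g₀ os).l₀ ∧ 0 < (cr F θ hP g₀ os).vol ∧
          (∀ (K : ℕ) (t : ℝ), |t| ≤ (cr F θ hP g₀ os).l₀ →
            T4GenFunBounds.schemeZ ((datumOfRecord₁₃CoPH F N θ hP).scheme g₀) os ((cr F θ hP g₀ os).K₀ + K) t =
              ∑ τ ∈ (cr F θ hP g₀ os).T K, (cr F θ hP g₀ os).A K t τ) ∧
          (∀ (K : ℕ) (t : ℝ), |t| ≤ (cr F θ hP g₀ os).l₀ →
            T4GenFunBounds.schemeZ ((datumOfRecord₁₃CoPH F N θ hP).scheme g₀) os ((cr F θ hP g₀ os).K₀ + K + 1) t =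
              ∑ τ ∈ (cr F θ hP g₀ os).T K, (cr F θ hP g₀ os).B K t τ))
    (h19 : ∀ (F : T4Family) (θ : Stage13HParams F N) (hP : θ.Provisos₁₃CoPH F N), Rg F θ → θ.Admissible F N → ∀ (g₀ : ℕ → ℝ) (os : List (ULoop F)),
      (∀ k : ℕ, RatesAt (datumOfRecord₁₃CoPH F N θ hP) (rateCarriersOfRecord₁₃CoPH 𝔯 F θ hP g₀ os k)) → letI := (cr F θ hP g₀ os).dec
        ∃ δ : ℕ → ℝ, NE7.Core (cr F θ hP g₀ os).l₀ (cr F θ hP g₀ os).vol (cr F θ hP g₀ os).T (cr F θ hP g₀ os).Bad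
          (fun K t τ => (cr F θ hP g₀ os).A K t τ - (cr F θ hP g₀ os).shA K t τ) (fun K t τ => (cr F θ hP g₀ os).B K t τ - (cr F θ hP g₀ os).shB K t τ) δ ∧
          Summable δ) :
    Spine (N := N) fun F D w => Node00.IsRecordOfRecord₁₃CCoPHOn F N Rg D w :=
  spine_rec13CCoPHOn_of_homes₁₃CoPHOn cr 𝔯 Rg h14 (s_N15_rRec₁₃CoPHOn_of_layers_forall_regime 𝔯 Rg h15) h16 h17 h18 h22 h20 h21 hx h19

/-- **N27 = B5 AT THE REGIME RECORD CLASS, N15 CLOSED AT THE LG-VECTOR KNIT READING** [MODEL level in the N15 slot]: if on the admissible tuples with provisos in the regime the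
reading's NE2 objects ARE the knit carriers of dag-n15-a's `U ≡ 1` Landau-gauge vector theory on the four-dimensional unit tori (`L ≥ 2`, `μ ≠ ν`), the N15 slot needs NO estimate
(part 74b `s_N15_rRec₁₃CoPHOn_of_knitReading`, `N15Knit.N15_with_zero_layers_dim4` underneath); the other slots displayed.  The distance to the statement of record is exactly the
reading equation `h15` (Node 00's pin of `ne2` to Bałaban's paired instances is NOT this model).  Every other hypothesis 0∕1 today. [bookkeeping] -/
theorem spine_rec13CCoPHOn_of_homes₁₃CoPHOn_n15KnitReading
    (L : ℕ) [NeZero L] (hL : 2 ≤ L) {μ ν : Fin 4} (hμν : μ ≠ ν) (a b μ' lam α β : Fin 4) (c35 p : ℝ)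
    (h15 : ∀ (F : T4Family) (θ : Stage13HParams F N) (hP : θ.Provisos₁₃CoPH F N), Rg F θ → θ.Admissible F N → ∀ (g₀ : ℕ → ℝ) (os : List (ULoop F)) (k : ℕ),
      (𝔯.lit F θ hP g₀ os).ne2 k =
        { I := KnitIndex 3 L, c35 := c35, p := p, pi := knitInstance 3 L, Kop := knitOp166 L μ ν a b, Ksite := knitSite163 L μ' lam,
          Kunit := covOpKernels L α β, inΛ := inAll L, unitDist := rhoDist L })
    (h14 : S_N14 (RRec₁₃CoPHOn 𝔯 Rg))
    (h16 : S_N16 (RRec₁₃CoPHOn 𝔯 Rg)) (h17 : S_N17 (RRec₁₃CoPHOn 𝔯 Rg))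
    (h18 : S_N18 (RRec₁₃CoPHOn 𝔯 Rg)) (h22 : S_N22 (RRec₁₃CoPHOn 𝔯 Rg)) (h20 : S_N20 (SRec₁₃CoPHOn cr Rg)) (h21 : S_N21 (SRec₁₃CoPHOn cr Rg))
    (hx : ∀ (F : T4Family) (θ : Stage13HParams F N) (hP : θ.Provisos₁₃CoPH F N), Rg F θ → θ.Admissible F N →
      B16.EndStatementBPrinted (datumOfRecord₁₃CoPH F N θ hP).C → DagBinding.EndpointExistence (datumOfRecord₁₃CoPH F N θ hP).C.toB12 →
        ForSmallCouplings (datumOfRecord₁₃CoPH F N θ hP) fun g₀ => ∀ os : List (ULoop F),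
          0 < (cr F θ hP g₀ os).l₀ ∧ 0 < (cr F θ hP g₀ os).vol ∧
          (∀ (K : ℕ) (t : ℝ), |t| ≤ (cr F θ hP g₀ os).l₀ →
            T4GenFunBounds.schemeZ ((datumOfRecord₁₃CoPH F N θ hP).scheme g₀) os ((cr F θ hP g₀ os).K₀ + K) t =
              ∑ τ ∈ (cr F θ hP g₀ os).T K, (cr F θ hP g₀ os).A K t τ) ∧
          (∀ (K : ℕ) (t : ℝ), |t| ≤ (cr F θ hP g₀ os).l₀ →
            T4GenFunBounds.schemeZ ((datumOfRecord₁₃CoPH F N θ hP).scheme g₀) os ((cr F θ hP g₀ os).K₀ + K + 1) t =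
              ∑ τ ∈ (cr F θ hP g₀ os).T K, (cr F θ hP g₀ os).B K t τ))
    (h19 : ∀ (F : T4Family) (θ : Stage13HParams F N) (hP : θ.Provisos₁₃CoPH F N), Rg F θ → θ.Admissible F N → ∀ (g₀ : ℕ → ℝ) (os : List (ULoop F)),
      (∀ k : ℕ, RatesAt (datumOfRecord₁₃CoPH F N θ hP) (rateCarriersOfRecord₁₃CoPH 𝔯 F θ hP g₀ os k)) → letI := (cr F θ hP g₀ os).dec
        ∃ δ : ℕ → ℝ, NE7.Core (cr F θ hP g₀ os).l₀ (cr F θ hP g₀ os).vol (cr F θ hP g₀ os).T (cr F θ hP g₀ os).Bad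
          (fun K t τ => (cr F θ hP g₀ os).A K t τ - (cr F θ hP g₀ os).shA K t τ) (fun K t τ => (cr F θ hP g₀ os).B K t τ - (cr F θ hP g₀ os).shB K t τ) δ ∧
          Summable δ) :
    Spine (N := N) fun F D w => Node00.IsRecordOfRecord₁₃CCoPHOn F N Rg D w :=
  spine_rec13CCoPHOn_of_homes₁₃CoPHOn cr 𝔯 Rg h14 (s_N15_rRec₁₃CoPHOn_of_knitReading 𝔯 Rg L hL hμν a b μ' lam α β c35 p h15) h16 h17 h18 h22 h20 h21 hx h19

/-! ## §2 The three at the guard of record `Rg := Node00.unityNondeg₁₃H N` (RR-2's CN class — one application of leaf B short of K3⁷ at `N = 2`) -/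

/-- **N27 = B5 AT THE CN RECORD CLASS, N15 READ AS NE2 AT THE READING's NE2 OBJECTS** — §1's θ-form at the guard of record (print's partition of unity `θ.ZhUnity F N` and
non-degenerate present slots).  Every hypothesis 0∕1 today. [bookkeeping] -/
theorem spine_rec13CCoPHN_of_homes₁₃CoPHOn_n15At
    (h14 : S_N14 (RRec₁₃CoPHOn 𝔯 (Node00.unityNondeg₁₃H N)))
    (h15 : ∀ (F : T4Family) (θ : Stage13HParams F N) (hP : θ.Provisos₁₃CoPH F N), (θ.ZhUnity F N ∧ θ.SlotsNondegenerate₁₃ F N) → θ.Admissible F N →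
      ∀ (g₀ : ℕ → ℝ) (os : List (ULoop F)) (k : ℕ), N15At (ne2OfRecord₁₁ ((𝔯.lit F θ hP g₀ os).ne2 k)))
    (h16 : S_N16 (RRec₁₃CoPHOn 𝔯 (Node00.unityNondeg₁₃H N)))
    (h17 : S_N17 (RRec₁₃CoPHOn 𝔯 (Node00.unityNondeg₁₃H N))) (h18 : S_N18 (RRec₁₃CoPHOn 𝔯 (Node00.unityNondeg₁₃H N)))
    (h22 : S_N22 (RRec₁₃CoPHOn 𝔯 (Node00.unityNondeg₁₃H N))) (h20 : S_N20 (SRec₁₃CoPHOn cr (Node00.unityNondeg₁₃H N))) (h21 : S_N21 (SRec₁₃CoPHOn cr (Node00.unityNondeg₁₃H N)))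
    (hx : ∀ (F : T4Family) (θ : Stage13HParams F N) (hP : θ.Provisos₁₃CoPH F N), (θ.ZhUnity F N ∧ θ.SlotsNondegenerate₁₃ F N) → θ.Admissible F N →
      B16.EndStatementBPrinted (datumOfRecord₁₃CoPH F N θ hP).C → DagBinding.EndpointExistence (datumOfRecord₁₃CoPH F N θ hP).C.toB12 →
        ForSmallCouplings (datumOfRecord₁₃CoPH F N θ hP) fun g₀ => ∀ os : List (ULoop F),
          0 < (cr F θ hP g₀ os).l₀ ∧ 0 < (cr F θ hP g₀ os).vol ∧
          (∀ (K : ℕ) (t : ℝ), |t| ≤ (cr F θ hP g₀ os).l₀ →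
            T4GenFunBounds.schemeZ ((datumOfRecord₁₃CoPH F N θ hP).scheme g₀) os ((cr F θ hP g₀ os).K₀ + K) t =
              ∑ τ ∈ (cr F θ hP g₀ os).T K, (cr F θ hP g₀ os).A K t τ) ∧
          (∀ (K : ℕ) (t : ℝ), |t| ≤ (cr F θ hP g₀ os).l₀ →
            T4GenFunBounds.schemeZ ((datumOfRecord₁₃CoPH F N θ hP).scheme g₀) os ((cr F θ hP g₀ os).K₀ + K + 1) t =
              ∑ τ ∈ (cr F θ hP g₀ os).T K, (cr F θ hP g₀ os).B K t τ))
    (h19 : ∀ (F : T4Family) (θ : Stage13HParams F N) (hP : θ.Provisos₁₃CoPH F N), (θ.ZhUnity F N ∧ θ.SlotsNondegenerate₁₃ F N) → θ.Admissible F N →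
      ∀ (g₀ : ℕ → ℝ) (os : List (ULoop F)), (∀ k : ℕ, RatesAt (datumOfRecord₁₃CoPH F N θ hP) (rateCarriersOfRecord₁₃CoPH 𝔯 F θ hP g₀ os k)) → letI := (cr F θ hP g₀ os).dec
        ∃ δ : ℕ → ℝ, NE7.Core (cr F θ hP g₀ os).l₀ (cr F θ hP g₀ os).vol (cr F θ hP g₀ os).T (cr F θ hP g₀ os).Bad
          (fun K t τ => (cr F θ hP g₀ os).A K t τ - (cr F θ hP g₀ os).shA K t τ) (fun K t τ => (cr F θ hP g₀ os).B K t τ - (cr F θ hP g₀ os).shB K t τ) δ ∧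
          Summable δ) :
    Spine (N := N) fun F D w => Node00.IsRecordOfRecord₁₃CCoPHN F N D w :=
  spine_rec13CCoPHOn_of_homes₁₃CoPHOn_n15At cr 𝔯 (Node00.unityNondeg₁₃H N) h14 h15 h16 h17 h18 h22 h20 h21 hx h19

/-- **N27 = B5 AT THE CN RECORD CLASS, N15 AS THE THREE NE2⁺ LAYERS** — §1's layers form at the guard of record.  Every hypothesis 0∕1 today. [bookkeeping] -/
theorem spine_rec13CCoPHN_of_homes₁₃CoPHOn_n15Layers
    (h14 : S_N14 (RRec₁₃CoPHOn 𝔯 (Node00.unityNondeg₁₃H N)))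
    (h15 : ∀ (F : T4Family) (θ : Stage13HParams F N) (hP : θ.Provisos₁₃CoPH F N), (θ.ZhUnity F N ∧ θ.SlotsNondegenerate₁₃ F N) → θ.Admissible F N →
      ∀ (g₀ : ℕ → ℝ) (os : List (ULoop F)) (k : ℕ),
      NE2PlusOperator ((𝔯.lit F θ hP g₀ os).ne2 k).c35 ((𝔯.lit F θ hP g₀ os).ne2 k).pi ((𝔯.lit F θ hP g₀ os).ne2 k).Kop ∧
      NE2PlusSite 4 ((𝔯.lit F θ hP g₀ os).ne2 k).p ((𝔯.lit F θ hP g₀ os).ne2 k).c35 ((𝔯.lit F θ hP g₀ os).ne2 k).pi ((𝔯.lit F θ hP g₀ os).ne2 k).Ksite ∧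
      NE2PlusUnit ((𝔯.lit F θ hP g₀ os).ne2 k).c35 ((𝔯.lit F θ hP g₀ os).ne2 k).pi ((𝔯.lit F θ hP g₀ os).ne2 k).Kunit ((𝔯.lit F θ hP g₀ os).ne2 k).inΛ
        ((𝔯.lit F θ hP g₀ os).ne2 k).unitDist)
    (h16 : S_N16 (RRec₁₃CoPHOn 𝔯 (Node00.unityNondeg₁₃H N)))
    (h17 : S_N17 (RRec₁₃CoPHOn 𝔯 (Node00.unityNondeg₁₃H N))) (h18 : S_N18 (RRec₁₃CoPHOn 𝔯 (Node00.unityNondeg₁₃H N)))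
    (h22 : S_N22 (RRec₁₃CoPHOn 𝔯 (Node00.unityNondeg₁₃H N))) (h20 : S_N20 (SRec₁₃CoPHOn cr (Node00.unityNondeg₁₃H N))) (h21 : S_N21 (SRec₁₃CoPHOn cr (Node00.unityNondeg₁₃H N)))
    (hx : ∀ (F : T4Family) (θ : Stage13HParams F N) (hP : θ.Provisos₁₃CoPH F N), (θ.ZhUnity F N ∧ θ.SlotsNondegenerate₁₃ F N) → θ.Admissible F N →
      B16.EndStatementBPrinted (datumOfRecord₁₃CoPH F N θ hP).C → DagBinding.EndpointExistence (datumOfRecord₁₃CoPH F N θ hP).C.toB12 →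
        ForSmallCouplings (datumOfRecord₁₃CoPH F N θ hP) fun g₀ => ∀ os : List (ULoop F),
          0 < (cr F θ hP g₀ os).l₀ ∧ 0 < (cr F θ hP g₀ os).vol ∧
          (∀ (K : ℕ) (t : ℝ), |t| ≤ (cr F θ hP g₀ os).l₀ →
            T4GenFunBounds.schemeZ ((datumOfRecord₁₃CoPH F N θ hP).scheme g₀) os ((cr F θ hP g₀ os).K₀ + K) t =
              ∑ τ ∈ (cr F θ hP g₀ os).T K, (cr F θ hP g₀ os).A K t τ) ∧
          (∀ (K : ℕ) (t : ℝ), |t| ≤ (cr F θ hP g₀ os).l₀ →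
            T4GenFunBounds.schemeZ ((datumOfRecord₁₃CoPH F N θ hP).scheme g₀) os ((cr F θ hP g₀ os).K₀ + K + 1) t =
              ∑ τ ∈ (cr F θ hP g₀ os).T K, (cr F θ hP g₀ os).B K t τ))
    (h19 : ∀ (F : T4Family) (θ : Stage13HParams F N) (hP : θ.Provisos₁₃CoPH F N), (θ.ZhUnity F N ∧ θ.SlotsNondegenerate₁₃ F N) → θ.Admissible F N →
      ∀ (g₀ : ℕ → ℝ) (os : List (ULoop F)), (∀ k : ℕ, RatesAt (datumOfRecord₁₃CoPH F N θ hP) (rateCarriersOfRecord₁₃CoPH 𝔯 F θ hP g₀ os k)) → letI := (cr F θ hP g₀ os).dec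
        ∃ δ : ℕ → ℝ, NE7.Core (cr F θ hP g₀ os).l₀ (cr F θ hP g₀ os).vol (cr F θ hP g₀ os).T (cr F θ hP g₀ os).Bad
          (fun K t τ => (cr F θ hP g₀ os).A K t τ - (cr F θ hP g₀ os).shA K t τ) (fun K t τ => (cr F θ hP g₀ os).B K t τ - (cr F θ hP g₀ os).shB K t τ) δ ∧
          Summable δ) :
    Spine (N := N) fun F D w => Node00.IsRecordOfRecord₁₃CCoPHN F N D w :=
  spine_rec13CCoPHOn_of_homes₁₃CoPHOn_n15Layers cr 𝔯 (Node00.unityNondeg₁₃H N) h14 h15 h16 h17 h18 h22 h20 h21 hx h19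

/-- **N27 = B5 AT THE CN RECORD CLASS, N15 CLOSED AT THE LG-VECTOR KNIT READING** [MODEL level in the N15 slot] — §1's knit-reading form at the guard of record. [bookkeeping] -/
theorem spine_rec13CCoPHN_of_homes₁₃CoPHOn_n15KnitReading
    (L : ℕ) [NeZero L] (hL : 2 ≤ L) {μ ν : Fin 4} (hμν : μ ≠ ν) (a b μ' lam α β : Fin 4) (c35 p : ℝ)
    (h15 : ∀ (F : T4Family) (θ : Stage13HParams F N) (hP : θ.Provisos₁₃CoPH F N), (θ.ZhUnity F N ∧ θ.SlotsNondegenerate₁₃ F N) → θ.Admissible F N →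
      ∀ (g₀ : ℕ → ℝ) (os : List (ULoop F)) (k : ℕ), (𝔯.lit F θ hP g₀ os).ne2 k =
        { I := KnitIndex 3 L, c35 := c35, p := p, pi := knitInstance 3 L, Kop := knitOp166 L μ ν a b, Ksite := knitSite163 L μ' lam,
          Kunit := covOpKernels L α β, inΛ := inAll L, unitDist := rhoDist L })
    (h14 : S_N14 (RRec₁₃CoPHOn 𝔯 (Node00.unityNondeg₁₃H N)))
    (h16 : S_N16 (RRec₁₃CoPHOn 𝔯 (Node00.unityNondeg₁₃H N)))
    (h17 : S_N17 (RRec₁₃CoPHOn 𝔯 (Node00.unityNondeg₁₃H N))) (h18 : S_N18 (RRec₁₃CoPHOn 𝔯 (Node00.unityNondeg₁₃H N)))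
    (h22 : S_N22 (RRec₁₃CoPHOn 𝔯 (Node00.unityNondeg₁₃H N))) (h20 : S_N20 (SRec₁₃CoPHOn cr (Node00.unityNondeg₁₃H N))) (h21 : S_N21 (SRec₁₃CoPHOn cr (Node00.unityNondeg₁₃H N)))
    (hx : ∀ (F : T4Family) (θ : Stage13HParams F N) (hP : θ.Provisos₁₃CoPH F N), (θ.ZhUnity F N ∧ θ.SlotsNondegenerate₁₃ F N) → θ.Admissible F N →
      B16.EndStatementBPrinted (datumOfRecord₁₃CoPH F N θ hP).C → DagBinding.EndpointExistence (datumOfRecord₁₃CoPH F N θ hP).C.toB12 →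
        ForSmallCouplings (datumOfRecord₁₃CoPH F N θ hP) fun g₀ => ∀ os : List (ULoop F),
          0 < (cr F θ hP g₀ os).l₀ ∧ 0 < (cr F θ hP g₀ os).vol ∧
          (∀ (K : ℕ) (t : ℝ), |t| ≤ (cr F θ hP g₀ os).l₀ →
            T4GenFunBounds.schemeZ ((datumOfRecord₁₃CoPH F N θ hP).scheme g₀) os ((cr F θ hP g₀ os).K₀ + K) t =
              ∑ τ ∈ (cr F θ hP g₀ os).T K, (cr F θ hP g₀ os).A K t τ) ∧
          (∀ (K : ℕ) (t : ℝ), |t| ≤ (cr F θ hP g₀ os).l₀ →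
            T4GenFunBounds.schemeZ ((datumOfRecord₁₃CoPH F N θ hP).scheme g₀) os ((cr F θ hP g₀ os).K₀ + K + 1) t =
              ∑ τ ∈ (cr F θ hP g₀ os).T K, (cr F θ hP g₀ os).B K t τ))
    (h19 : ∀ (F : T4Family) (θ : Stage13HParams F N) (hP : θ.Provisos₁₃CoPH F N), (θ.ZhUnity F N ∧ θ.SlotsNondegenerate₁₃ F N) → θ.Admissible F N →
      ∀ (g₀ : ℕ → ℝ) (os : List (ULoop F)), (∀ k : ℕ, RatesAt (datumOfRecord₁₃CoPH F N θ hP) (rateCarriersOfRecord₁₃CoPH 𝔯 F θ hP g₀ os k)) → letI := (cr F θ hP g₀ os).dec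
        ∃ δ : ℕ → ℝ, NE7.Core (cr F θ hP g₀ os).l₀ (cr F θ hP g₀ os).vol (cr F θ hP g₀ os).T (cr F θ hP g₀ os).Bad
          (fun K t τ => (cr F θ hP g₀ os).A K t τ - (cr F θ hP g₀ os).shA K t τ) (fun K t τ => (cr F θ hP g₀ os).B K t τ - (cr F θ hP g₀ os).shB K t τ) δ ∧
          Summable δ) :
    Spine (N := N) fun F D w => Node00.IsRecordOfRecord₁₃CCoPHN F N D w :=
  spine_rec13CCoPHOn_of_homes₁₃CoPHOn_n15KnitReading cr 𝔯 (Node00.unityNondeg₁₃H N) L hL hμν a b μ' lam α β c35 p h15 h14 h16 h17 h18 h22 h20 h21 hx h19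

end Summit.QuantumFields.YangMills.Theorems.BalabanUVNodesN27SpineRecord

end
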